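import Literature.Probability.Percolation.QuadCrossingBelowRegion
import Literature.Probability.Percolation.QuadCrossingDuality
import Literature.Probability.Percolation.QuadCrossingSubquadArm
import Literature.Probability.Percolation.DualFaceChains
import Literature.Probability.Percolation.QuadCrossingPathReparam
import HarnessLib

/-!
# The closed arm at the landing point: `¬⊞_Q` forces a dual annulus crossing (Lemma 6.1, case (2))

Topic `Probability/Percolation`; proofs file towards Schramm–Smirnov's continuity Lemma 6.1
(`SchrammSmirnov2011_lemma_6_1`, file `QuadCrossingContinuity.lean`; O. Schramm, S. Smirnov, *On the
scaling limits of planar percolation*, Ann. Probab. 39 (2011), arXiv:1101.5820, §6, p. 22): "The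
event `¬⊞_Q` would imply that `γ` cannot be connected to `∂₂Q` by a crossing inside `[Q] ∖ M`.
Hence, there is a dual closed crossing from `∂₃Q` to `(σ₃ ∩ M̄) ∪ ∂₁Q`, in particular crossing the
annulus `A(x, δ, d₁/2)` inside `[Q] ∖ M`."

This file proves the DETERMINISTIC content of that step for a general quad, in the tree's
vocabulary (the perturbation size is `ρ`, the mesh `δ`): let `L ⊆ [Q]` be a compact connected set
inside the drawn open edges meeting `∂₀Q` (the open crossing `γ` of the inner quad) and containing a
point `x⋆` all of whose junctions to `∂₃Q` inside `[Q]` have diameter `≥ c₃` (`x⋆ ∈ σ₃`), and let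
`α` be a path in `[Q]` from `x⋆` to `∂₂Q` of diameter `≤ ρ` (the short junction of condition (2)).
If `Q` has no open crossing, then the dual path of `Q` (`Quad.exists_path_avoiding_of_not_exists_isCrossing`,
off the open edges and the drawn lattice points) starts below `W = L ∪ α`
(`Quad.side_one_subset_below`) and ends on `∂₃Q` off the region; after its last visit to the region —
which is on `α`, within `ρ` of `x⋆` (`Quad.exists_final_segment_avoiding_below`) — it is a path off
the open edges from `B̄(x⋆, ρ)` reaching distance `≥ c₃/2` from `x⋆`; its lattice shadow is a
dual-open chain crossing the annulus (`mem_annulusDualCrossing_of_path`):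

* `Quad.mem_annulusDualCrossing_of_not_exists_isCrossing` — **the closed arm**:
  `ω ∈ annulusDualCrossing x⋆ δ (ρ + 2δ) (c₃/2 - 2δ)` whenever `ρ + 2δ ≤ c₃/2`.

What is NOT here: that this dual chain uses only edges off the region below `W` ("the restriction
of `ω` to `[Q] ∖ M` is unbiased") — the decoupling half of the step.

## References

* O. Schramm, S. Smirnov, Ann. Probab. 39 (2011) 1768–1814, arXiv:1101.5820, proof of Lemma 6.1,
  case (2), eq. (6.2). [SchrammSmirnov2011]
-/

noncomputable section

open scoped unitInterval
open Set Filter Metric Function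
open _root_.Topology
open Literature.Probability.LatticeModels

namespace Literature.Probability.Percolation

namespace QuadCrossing

variable {D : Set ℂ}

namespace Quad

variable {Q : Quad D} {δ : ℝ} {ω : BondConfig (Site 2)}

/-- **The closed arm at the landing point** (deterministic half of eq. (6.2) in the proof of
Schramm–Smirnov's Lemma 6.1).  Let `L ⊆ [Q] ∩ openEdgeUnion δ ω` (`δ > 0`) be compact, connected
and meet `∂₀Q`; let `x⋆ ∈ L` have all its junctions to `∂₃Q` inside `[Q]` of diameter `≥ c₃`; let `α`
be a path in `[Q]` from `x⋆` to `∂₂Q` with `diam α ≤ ρ`, and `ρ + 2δ ≤ c₃ / 2`.  If `Q` has no crossing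
inside the open edges, then `ω ∈ annulusDualCrossing x⋆ δ (ρ + 2δ) (c₃/2 - 2δ)`: the dual path of
`Q` from `∂₁Q` (below `L ∪ α`) to `∂₃Q` (not below) last leaves the region below `L ∪ α` at a point
of `α` — it cannot touch `L` — and then, being the continuation to `∂₃Q` of a junction from `x⋆`,
reaches distance `≥ c₃/2` from `x⋆`; the piece up to its first exit from `B(x⋆, c₃/2)` is shadowed
by a dual-open chain of faces. [cite: SchrammSmirnov2011, proof of Lemma 6.1, case (2), eq. (6.2)] -/
theorem mem_annulusDualCrossing_of_not_exists_isCrossing (hδ : 0 < δ) {L : Set ℂ}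
    (hLc : IsCompact L) (hLconn : IsConnected L) (hLQ : L ⊆ Q.carrier)
    (hLO : L ⊆ openEdgeUnion δ ω) (hL0 : (L ∩ Q.side 0).Nonempty) {x : ℂ} (hxL : x ∈ L) {c₃ : ℝ}
    (hfar : ∀ t ∈ Q.side 3, ∀ p : Path x t, range p ⊆ Q.carrier → c₃ ≤ Metric.diam (range p))
    {ρ : ℝ} (hρ : 0 ≤ ρ) {y₂ : ℂ} (hy₂ : y₂ ∈ Q.side 2) (α : Path x y₂) (hα : range α ⊆ Q.carrier)
    (hαdiam : Metric.diam (range α) ≤ ρ) (hρc : ρ + 2 * δ ≤ c₃ / 2)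
    (hnot : ¬ ∃ K, Q.IsCrossing K ∧ K ⊆ openEdgeUnion δ ω) :
    ω ∈ annulusDualCrossing x δ (ρ + 2 * δ) (c₃ / 2 - 2 * δ) := by
  have hρc₃ : ρ < c₃ / 2 := by linarith
  -- the dual path of `Q`
  obtain ⟨β, hβc, hβQ, hβ0, hβ1, hβO⟩ := Q.exists_path_avoiding_of_not_exists_isCrossing hδ hnot
  -- the set `W = L ∪ α` and the region below it
  set W : Set ℂ := L ∪ range α with hW
  have hWc : IsCompact W := hLc.union (isCompact_range α.continuous)
  have hWconn : IsConnected W := hLconn.union ⟨x, hxL, ⟨0, α.source⟩⟩ (isConnected_range α.continuous)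
  have hWQ : W ⊆ Q.carrier := union_subset hLQ hα
  have hW0 : (W ∩ Q.side 0).Nonempty := hL0.mono (inter_subset_inter_left _ subset_union_left)
  have hW2 : (W ∩ Q.side 2).Nonempty := ⟨y₂, Or.inr ⟨1, α.target⟩, hy₂⟩
  set M : Set ℂ := {z | z ∈ Q.carrier ∧ ∀ t ∈ Q.side 3, ∀ p : Path z t,
      range p ⊆ Q.carrier → (range p ∩ W).Nonempty} with hM
  -- points of `α` are within `ρ` of `x`
  have hαx : ∀ s, dist (α s) x ≤ ρ := fun s =>
    (dist_le_diam_of_mem (isCompact_range α.continuous).isBounded ⟨s, rfl⟩ ⟨0, α.source⟩).trans hαdiam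
  -- no point of `∂₃Q` is on `α` (junctions from `x` to `∂₃Q` have diameter `≥ c₃ > ρ`)
  have hα3 : ∀ s, α s ∉ Q.side 3 := by
    intro s hs
    -- the initial segment of `α` up to `s`
    let p : Path x (α s) :=
      { toFun := fun t => α.extend ((t : ℝ) * s)
        continuous_toFun := α.continuous_extend.comp (by fun_prop)
        source' := by simp
        target' := by simp }
    have hp : range p ⊆ range α := by
      rintro _ ⟨t, rfl⟩
      exact ⟨projIcc 0 1 zero_le_one _, rfl⟩
    have := hfar (α s) hs p (hp.trans hα)
    have hle : Metric.diam (range p) ≤ ρ :=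
      (diam_mono hp (isCompact_range α.continuous).isBounded).trans hαdiam
    linarith
  -- `β 0` is below `W`, `β 1` is not
  have hβ0M : β 0 ∈ M := Quad.side_one_subset_below hWc hWconn.isPreconnected hWQ hW0 hW2 hβ0
  have hβ1W : β 1 ∉ W := by
    rintro (h | ⟨s, hs⟩)
    · exact (hβO 1 (right_mem_Icc.2 zero_le_one)).1 (hLO h)
    · exact hα3 s (hs ▸ hβ1)
  have hβ1M : β 1 ∉ M :=
    Quad.not_mem_below_of_path_avoiding hβ1 (Path.refl (β 1)) (by
      rintro _ ⟨t, rfl⟩; exact hβQ (right_mem_Icc.2 zero_le_one)) (fun _ => by simpa using hβ1W)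
  -- last visit to `M`: at a point of `W`, hence of `α`
  obtain ⟨s₀, hs₀, hs₀W, hafter⟩ :=
    Quad.exists_final_segment_avoiding_below hWc.isClosed hβc hβQ hβ0M hβ1M
  have hs₀α : dist (β s₀) x ≤ ρ := by
    rcases hs₀W with h | ⟨s, hs⟩
    · exact absurd (hLO h) (hβO s₀ ⟨hs₀.1, hs₀.2.le⟩).1
    · rw [← hs]; exact hαx s
  -- the final segment, reparametrised: `γ : [0,1] → [Q]`, off the open edges, from `β s₀` to `∂₃Q`
  obtain ⟨hγc, hγ0, hγ1, hγmaps⟩ := exists_reparam hβc hs₀.1 hs₀.2.le le_rfl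
  set γ : ℝ → ℂ := fun t => β (s₀ + t * (1 - s₀)) with hγ
  have hγO : ∀ t ∈ Icc (0 : ℝ) 1, γ t ∉ openEdgeUnion δ ω := fun t ht =>
    (hβO _ (let h := hγmaps t ht; ⟨hs₀.1.trans h.1, h.2⟩)).1
  have hγQ : ∀ t ∈ Icc (0 : ℝ) 1, γ t ∈ Q.carrier := fun t ht =>
    hβQ (let h := hγmaps t ht; ⟨hs₀.1.trans h.1, h.2⟩)
  -- `γ` reaches distance `≥ c₃ / 2` from `x`
  have hfarpt : ∃ t ∈ Icc (0 : ℝ) 1, c₃ / 2 ≤ dist (γ t) x := by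
    by_contra hcon
    push Not at hcon
    -- the junction `x ⟶ β s₀ ⟶ ∂₃Q` would have diameter `< c₃`
    obtain ⟨s, hs⟩ : β s₀ ∈ range α := by
      rcases hs₀W with h | h
      · exact absurd (hLO h) (hβO s₀ ⟨hs₀.1, hs₀.2.le⟩).1
      · exact h
    let p₁ : Path x (β s₀) :=
      { toFun := fun t => α.extend ((t : ℝ) * s)
        continuous_toFun := α.continuous_extend.comp (by fun_prop)
        source' := by simp
        target' := by simp [hs] }
    obtain ⟨p₂, hp₂⟩ := exists_path_of_continuousOn hγc
    have hp₁ : range p₁ ⊆ range α := by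
      rintro _ ⟨t, rfl⟩; exact ⟨projIcc 0 1 zero_le_one _, rfl⟩
    have hp₂r : range p₂ ⊆ γ '' Icc 0 1 := by
      rintro _ ⟨t, rfl⟩; exact ⟨t, t.2, (hp₂ t).symm⟩
    have e0 : γ 0 = β s₀ := hγ0
    have e1 : γ 1 = β 1 := hγ1
    -- the concatenation, as a path from `x` to `β 1 ∈ ∂₃Q`
    let p : Path x (β 1) := p₁.trans ((p₂.cast e0.symm e1.symm))
    have hprange : range p ⊆ range α ∪ γ '' Icc 0 1 := by
      rw [Path.trans_range]
      refine union_subset_union hp₁ ?_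
      intro z hz
      rw [Path.cast_coe] at hz
      exact hp₂r hz
    have hpQ : range p ⊆ Q.carrier := hprange.trans (union_subset hα (by
      rintro _ ⟨t, ht, rfl⟩; exact hγQ t ht))
    have hdiam := hfar (β 1) hβ1 p hpQ
    -- but every point of `range α ∪ γ([0,1])` is within `< c₃/2` of `x`
    have hK : IsCompact (range α ∪ γ '' Icc 0 1) :=
      (isCompact_range α.continuous).union (isCompact_Icc.image_of_continuousOn hγc)
    obtain ⟨m, hm, hmax⟩ := hK.exists_isMaxOn ⟨x, Or.inl ⟨0, α.source⟩⟩
      (continuous_id.dist continuous_const).continuousOn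
    have hmlt : dist m x < c₃ / 2 := by
      rcases hm with ⟨s', rfl⟩ | ⟨t, ht, rfl⟩
      · exact (hαx s').trans_lt hρc₃
      · exact hcon t ht
    have hbound : Metric.diam (range p) ≤ 2 * dist m x := by
      refine Metric.diam_le_of_forall_dist_le (by positivity) fun u hu v hv => ?_
      have hu' : dist u x ≤ dist m x := hmax (hprange hu)
      have hv' : dist v x ≤ dist m x := hmax (hprange hv)
      linarith [dist_triangle u x v, dist_comm x v]
    linarith
  obtain ⟨t₁, ht₁, ht₁far⟩ := hfarpt
  -- restrict `γ` to `[0, t₁]` and then up to its first exit from `B(x, c₃/2)`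
  obtain ⟨hγ'c, hγ'0, hγ'1, hγ'maps⟩ := exists_reparam hγc le_rfl ht₁.1 ht₁.2
  set γ' : ℝ → ℂ := fun t => γ (0 + t * (t₁ - 0)) with hγ'
  have h0 : dist (γ' 0) x < c₃ / 2 := by
    rw [hγ'0, hγ0]; exact hs₀α.trans_lt hρc₃
  have h1 : c₃ / 2 ≤ dist (γ' 1) x := by rw [hγ'1]; exact ht₁far
  obtain ⟨γ'', hγ''c, hγ''0, hγ''mem, hγ''R, hγ''1⟩ := exists_restrict_until_dist_ge hγ'c h0 h1
  have hγ''O : ∀ t ∈ Icc (0 : ℝ) 1, γ'' t ∉ openEdgeUnion δ ω := fun t ht => by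
    obtain ⟨u, hu, hu'⟩ := hγ''mem t ht
    rw [← hu']
    obtain ⟨h1u, h2u⟩ := hγ'maps u hu
    exact hγO _ ⟨by linarith, by nlinarith [ht₁.2]⟩
  have h0' : dist (γ'' 0) x ≤ ρ := by rw [hγ''0, hγ'0, hγ0]; exact hs₀α
  have key := mem_annulusDualCrossing_of_path hδ x hγ''c hγ''O h0' hγ''R hγ''1 hρc
  exact key

end Quad

end QuadCrossing

end Literature.Probability.Percolation
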